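import Literature.Probability.FitznerVanDerHofstad2017.NobleJointTwoLevelIotaKit
import Literature.Probability.FitznerVanDerHofstad2017.NobleBoundsN1Cls22
import HarnessLib

/-!
# Fitzner–van der Hofstad (2017), §6.1: the class `(a,b) = (2,0)` of (6.4) at `N = 1` for the `ι`-event

[FvdH17] = R. Fitzner, R. van der Hofstad, *Mean-field behavior for nearest-neighbor percolation in `d > 10`*,
Electron. J. Probab. **22** (2017), no. 43, arXiv:1506.07977v2; §6.1 proof of Lemma 5.3 (pp. 58–59):
"Case `a ≥ 2`" of the `Ξ^ι` start, "Case `a ≥ 2`, `b = 0`" of the middle piece, the `b = 0` right triangle.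

The class estimate `h2 (2,0)` of `NobleBoundsN1IotaReduce.tsum_ofReal_nobleXiIotaN_one_le_of_cls₁₂` for the event
`E ι x = NobleJointTwoLevelIota.jointWitIota ι x`:
`J(v−u) ℙ_p^{⊗2}(jointWitIota ∩ class (2,0)) ≤ Σ_κ 𝟙{v = u+e_κ} P^{ι,2}(u,w) Ā'^{κ,2,0}(u,w,t,z) P^{E,0}(t−x,z−x)`.
Absorbed style (`NobleBoundsN1Class00` pattern: `p = J(v−u)` becomes the open bond `b₀ = (u,v)` on level `0`, the line
`{u ←1̲→ v}` of `Ā^{κ,2,0}`): on the class `z = t`; for `u = e_ι` only part `II` is live with start `P^{ι,2}(e_ι,w)`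
(`NobleBoundsN1IotaStart`, rows `two_base_*`); for `u ≠ e_ι` both parts are live, bounded by the two summands of
`P^{ι,2}(u,w)` (`NobleJointTwoLevelIotaKit` §F) and added.  Middle `{u ←1̲→ v}₀ ∘ {v ←1→ t}₁ ∘ {t ↔ w}₀ ≤ Ā'^{κ,2,0}`
(`NobleBoundsN1ClassTools.piPerc_mid_two_zero_le_blockAbar'`), end `{x↔t}₁ ∘ {x↔t}₁ ≤ P^{E,0}`
(`piPerc_end_zero_le_blockPE`).  Unconditional, every `d` and `p`.
-/

namespace Literature.Probability.FitznerVanDerHofstad2017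

open Literature.Barriers.CriticalPhenomena Literature.Probability.Percolation Literature.Probability.LatticeModels
open Literature.Combinatorics.SimpleGraph _root_.SimpleGraph _root_.MeasureTheory
open Literature.Probability.FitznerVanDerHofstad2017.NobleBlocks
open Literature.Probability.FitznerVanDerHofstad2017.NobleBlocks.LenIdx
open scoped ENNReal BigOperators

variable {d : ℕ}

namespace IotaCls20

/-! ### The upgraded line families (ten lines: five level-`0`, the absorbed bond, four level-`1`) -/

/-- Level `1`, class `b = 0` (`z = t`): `{v ←1→ t}, {t ↔ t}, {x ↔ t}, {x ↔ t}`. [cite: FitznerVanDerHofstad2017, §6.1 right triangle, b = 0 (arXiv:1506.07977v2 p. 59)] -/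
def lv1 (v t x : Site d) : Fin 4 → Set (BondConfig (Site d)) :=
  ![event (ge 1) v t, event (ge 0) t t, event (ge 0) x t, event (ge 0) x t]

/-- Assemble a ten-line family from its five level-`0` lines. [cite: FitznerVanDerHofstad2017, §6.1 (6.4) (arXiv:1506.07977v2 p. 58)] -/
def mk (L₀ : Fin 5 → Set (BondConfig (Site d))) (u v t x : Site d) : (Fin 5 ⊕ Fin 1) ⊕ Fin 4 → Set (BondConfig (Site d)) :=
  Sum.elim (Sum.elim L₀ ![event (eq 1) u v]) (lv1 v t x)

/-- Finitarity of an assembled family. [cite: FitznerVanDerHofstad2017, §4.2 Def. 4.1 (arXiv:1506.07977v2 p. 35)] -/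
theorem isFinitary_mk {L₀ : Fin 5 → Set (BondConfig (Site d))} (hL : ∀ i, IsFinitary (L₀ i)) (u v t x : Site d) :
    ∀ i, IsFinitary (mk L₀ u v t x i) := by
  rintro ((i | i) | j)
  · exact hL i
  · fin_cases i; exact isFinitary_event (eq 1) u v
  · fin_cases j
    exacts [isFinitary_event (ge 1) v t, isFinitary_event (ge 0) t t, isFinitary_event (ge 0) x t,
      isFinitary_event (ge 0) x t]

/-- Part `II`, `u = e`, `w = 0`. [cite: FitznerVanDerHofstad2017, §6.1 Case a ≥ 2 (arXiv:1506.07977v2 p. 59)] -/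
def l0B0 (e t : Site d) : Fin 5 → Set (BondConfig (Site d)) :=
  ![event (ge 0) 0 0, event (ge 3) 0 e, event (ge 0) e e, event (ge 0) e e, event (ge 0) t 0]

/-- Part `II`, `u = e`, `w ≠ 0`. [cite: FitznerVanDerHofstad2017, §6.1 Case a ≥ 2 (arXiv:1506.07977v2 p. 59)] -/
def l0Bw (e w t : Site d) : Fin 5 → Set (BondConfig (Site d)) :=
  ![event (ge 1) 0 w, event (ge 2) w e, event (ge 0) e e, event (ge 0) e e, event (ge 0) t w]

/-- Part `I`, `u ≠ e`, `w ≠ e`. [cite: FitznerVanDerHofstad2017, §6.1 Case a ≥ 2 (arXiv:1506.07977v2 p. 59)] -/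
def l0Iw (e u w t : Site d) : Fin 5 → Set (BondConfig (Site d)) :=
  ![event (ge 3) 0 e, event (ge 1) w e, event (ge 2) u w, event (ge 0) t w, event (ge 1) e u]

/-- Part `I`, `u ≠ e`, `w = e`. [cite: FitznerVanDerHofstad2017, §6.1 Case a ≥ 2 (arXiv:1506.07977v2 p. 59)] -/
def l0Ie (e u t : Site d) : Fin 5 → Set (BondConfig (Site d)) :=
  ![event (ge 3) 0 e, event (ge 0) e e, event (ge 2) e u, event (ge 0) t e, event (ge 2) e u]

/-- Part `II`, `u ≠ e`, `w = 0`. [cite: FitznerVanDerHofstad2017, §6.1 Case a ≥ 2 (arXiv:1506.07977v2 p. 59)] -/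
def l0F0 (e u t : Site d) : Fin 5 → Set (BondConfig (Site d)) :=
  ![event (ge 0) 0 0, event (ge 3) 0 e, event (ge 0) e u, event (ge 0) e u, event (ge 0) t 0]

/-- Part `II`, `u ≠ e`, `w ≠ 0`. [cite: FitznerVanDerHofstad2017, §6.1 Case a ≥ 2 (arXiv:1506.07977v2 p. 59)] -/
def l0Fw (e u w t : Site d) : Fin 5 → Set (BondConfig (Site d)) :=
  ![event (ge 1) 0 w, event (ge 1) w e, event (ge 0) e u, event (ge 0) e u, event (ge 0) t w]

/-- [cite: FitznerVanDerHofstad2017, §4.2 Def. 4.1 (arXiv:1506.07977v2 p. 35)] -/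
theorem isFinitary_l0B0 (e t : Site d) : ∀ i, IsFinitary (l0B0 (d := d) e t i) := by
  intro i; fin_cases i
  exacts [isFinitary_event (ge 0) 0 0, isFinitary_event (ge 3) 0 e, isFinitary_event (ge 0) e e,
    isFinitary_event (ge 0) e e, isFinitary_event (ge 0) t 0]

/-- [cite: FitznerVanDerHofstad2017, §4.2 Def. 4.1 (arXiv:1506.07977v2 p. 35)] -/
theorem isFinitary_l0Bw (e w t : Site d) : ∀ i, IsFinitary (l0Bw (d := d) e w t i) := by
  intro i; fin_cases i
  exacts [isFinitary_event (ge 1) 0 w, isFinitary_event (ge 2) w e, isFinitary_event (ge 0) e e,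
    isFinitary_event (ge 0) e e, isFinitary_event (ge 0) t w]

/-- [cite: FitznerVanDerHofstad2017, §4.2 Def. 4.1 (arXiv:1506.07977v2 p. 35)] -/
theorem isFinitary_l0Iw (e u w t : Site d) : ∀ i, IsFinitary (l0Iw (d := d) e u w t i) := by
  intro i; fin_cases i
  exacts [isFinitary_event (ge 3) 0 e, isFinitary_event (ge 1) w e, isFinitary_event (ge 2) u w,
    isFinitary_event (ge 0) t w, isFinitary_event (ge 1) e u]

/-- [cite: FitznerVanDerHofstad2017, §4.2 Def. 4.1 (arXiv:1506.07977v2 p. 35)] -/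
theorem isFinitary_l0Ie (e u t : Site d) : ∀ i, IsFinitary (l0Ie (d := d) e u t i) := by
  intro i; fin_cases i
  exacts [isFinitary_event (ge 3) 0 e, isFinitary_event (ge 0) e e, isFinitary_event (ge 2) e u,
    isFinitary_event (ge 0) t e, isFinitary_event (ge 2) e u]

/-- [cite: FitznerVanDerHofstad2017, §4.2 Def. 4.1 (arXiv:1506.07977v2 p. 35)] -/
theorem isFinitary_l0F0 (e u t : Site d) : ∀ i, IsFinitary (l0F0 (d := d) e u t i) := by
  intro i; fin_cases i
  exacts [isFinitary_event (ge 0) 0 0, isFinitary_event (ge 3) 0 e, isFinitary_event (ge 0) e u,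
    isFinitary_event (ge 0) e u, isFinitary_event (ge 0) t 0]

/-- [cite: FitznerVanDerHofstad2017, §4.2 Def. 4.1 (arXiv:1506.07977v2 p. 35)] -/
theorem isFinitary_l0Fw (e u w t : Site d) : ∀ i, IsFinitary (l0Fw (d := d) e u w t i) := by
  intro i; fin_cases i
  exacts [isFinitary_event (ge 1) 0 w, isFinitary_event (ge 1) w e, isFinitary_event (ge 0) e u,
    isFinitary_event (ge 0) e u, isFinitary_event (ge 0) t w]

/-! ### Facts of the class -/

/-- On `jointWitIota ∩ class (2,0)`: the side conditions, `u ≠ w` and `t = z`.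
[cite: FitznerVanDerHofstad2017, §6.1 "Case a = 2", "b = 0" (arXiv:1506.07977v2 pp. 58–59)] -/
theorem facts {ι : Fin d × Bool} {x u v w z t : Site d} {ω : Fin 2 → BondConfig (Site d)}
    (hω : ω ∈ jointWitIota ι x u v w z t ∩ clsSet u w t z 2 0) : JWιSide u v w z t x ∧ u ≠ w ∧ t = z := by
  have hs : JWιSide u v w z t x := by
    rcases hω.1 with h | h
    exacts [h.1, h.1]
  exact ⟨hs, ((mem_lineCls_two_iff u w 0 ω).1 hω.2.1).1, (mem_lineCls_zero_iff t z 1 ω).1 hω.2.2⟩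

/-- The level-`1` upgrades of class `b = 0` (`z = t`, `v ≠ t`). [cite: FitznerVanDerHofstad2017, §6.1 right triangle, b = 0 (arXiv:1506.07977v2 p. 59)] -/
theorem up₁ {E C : Set (Fin 2 → BondConfig (Site d))} {u v t x : Site d} (hvt : v ≠ t) :
    ∀ ω ∈ E ∩ C, ∀ (j : Fin 4) (K : Set (Sym2 (Site d))), K ⊆ ω 1 → (∀ e ∈ K, u ∉ e) →
      K ∈ jwLines₁ v t t x j → K ∈ lv1 v t x j := by
  intro ω _ j K _ _ hL
  fin_cases j
  · exact mem_openConnGe_one_of_ne hL hvt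
  · exact mem_openConnGe_zero_of_mem hL
  · have hL' : K ∈ (openConn t x : Set (BondConfig (Site d))) := hL
    exact mem_openConnGe_zero_of_mem (SimpleGraph.Reachable.symm hL')
  · have hL' : K ∈ (openConn t x : Set (BondConfig (Site d))) := hL
    exact mem_openConnGe_zero_of_mem (SimpleGraph.Reachable.symm hL')

/-- A closed bond of `ω₀` is missed by every `K ⊆ ω₀`, in either orientation. [cite: FitznerVanDerHofstad2017, §6.1 Case a = 2 (arXiv:1506.07977v2 p. 59)] -/
theorem notMem_of_subset {K ω₀ : BondConfig (Site d)} {a b : Site d} (hK : K ⊆ ω₀) (hb : s(a, b) ∉ ω₀) :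
    s(a, b) ∉ K ∧ s(b, a) ∉ K :=
  ⟨fun h => hb (hK h), fun h => hb (hK (by rw [Sym2.eq_swap]; exact h))⟩

/-- The three factors of the absorbed style assemble. [cite: FitznerVanDerHofstad2017, §6.1 (6.4) (arXiv:1506.07977v2 p. 58)] -/
theorem le_blocks_of_factors {X F₀ F₁ F₂ S A E : ℝ≥0∞} (h3 : X ≤ F₀ * F₁ * F₂) (hS : F₀ ≤ S) (hA : F₁ ≤ A)
    (hE : F₂ ≤ E) : X ≤ S * A * E :=
  h3.trans (mul_le_mul' (mul_le_mul' hS hA) hE)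

end IotaCls20

open IotaCls20

section

variable (p : unitInterval)

/-- **Class `(2,0)`, `u = e_ι`**: only part `II` is live; start `P^{ι,2}(e_ι,w)`.
[cite: FitznerVanDerHofstad2017, §6.1 proof of Lemma 5.3, Case a ≥ 2 with `u = e_ι`, "Case a ≥ 2, b = 0" (arXiv:1506.07977v2 p. 59)] -/
theorem jointWitIota_cls_two_zero_of_eq {ι : Fin d × Bool} {u : Site d} (hu : u = stepVec ι) (x v w z t : Site d) :
    ENNReal.ofReal (bondJ d p (v - u)) * piPerc d p 2 (jointWitIota ι x u v w z t ∩ clsSet u w t z 2 0) ≤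
      ∑ κ : Fin d × Bool, (if v = u + stepVec κ then (1 : ℝ≥0∞) else 0) *
        (blockPiota (Letters.perc d p) ι 2 u w * blockAbar' (Letters.perc d p) κ 2 0 u w t z *
          blockPE (Letters.perc d p) 0 (t - x) (z - x)) := by
  classical
  refine ofReal_bondJ_mul_le_sum_ite p u v _ _ fun κ hv => ?_
  by_cases hne : (jointWitIota ι x u v w z t ∩ clsSet u w t z 2 0).Nonempty
  swap
  · rw [Set.not_nonempty_iff_eq_empty.1 hne, measure_empty, mul_zero]; exact zero_le
  obtain ⟨ω₀, hω₀⟩ := hne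
  obtain ⟨hs, -, hzt⟩ := facts hω₀
  subst hzt
  have hvt : v ≠ t := fun h => hs.2.2.2.1 h.symm
  have huv : u ≠ v := (adj_of_eq_add_stepVec hv).ne
  rw [jointWitIota_inter_eq_of_I (jointWitIotaI_inter_clsSet_eq_empty_of_eq hu x v w t t (a := 2) (by decide) 0)]
  subst hu
  rw [ofReal_mul_piPerc_eq_inter_of_preimage p hv
    ((measurableSet_jointWitIotaII ι x (stepVec ι) v w t t).inter (measurableSet_clsSet (stepVec ι) w t t 2 0))
    (eraseAt0_preimage_jointWitIotaII_inter_clsSet ι x (stepVec ι) v w t t 2 0)]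
  by_cases hw0 : w = 0
  · subst hw0
    have h3 := piPerc_inter_le_prod₃_of_witnessedι₀ p (C := clsSet (stepVec ι) 0 t t 2 0)
      (fun ω (hω : ω ∈ jointWitIotaII ι x (stepVec ι) v 0 t t) => hω.2.2.2.2.2)
      (mk (l0B0 (stepVec ι) t) (stepVec ι) v t x) (isFinitary_mk (isFinitary_l0B0 _ t) _ v t x) grpιII₀ grpιII₀_adm
      (fun ω hω hlat i K hK _ hL hI _ => by
        fin_cases i
        · exact mem_openConnGe_zero_of_mem hL
        · exact mem_event_ge_three_zero_stepVec hlat hK hL (hI (Finset.notMem_empty _))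
        · exact mem_openConnGe_zero_of_mem hL
        · exact mem_openConnGe_zero_of_mem hL
        · have hL' : K ∈ (openConn (0 : Site d) t : Set (BondConfig (Site d))) := hL
          exact mem_openConnGe_zero_of_mem (SimpleGraph.Reachable.symm hL'))
      (mem_openConnEq_one_of_mem huv (Set.mem_singleton _)) (up₁ hvt)
    refine le_blocks_of_factors h3 ?_ ?_ ?_
    · exact piPerc_grp_le _ _ _ 0 ![Sum.inl (Sum.inl 1)] (by decide) (by decide) (by funext m; fin_cases m; rfl)
        (piPerc_iotaStart_two_base_zero_le_blockPiota p ι _)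
    · exact piPerc_grp_le _ _ _ 1 ![Sum.inl (Sum.inr 0), Sum.inr 0, Sum.inl (Sum.inl 4)] (by decide) (by decide)
        (by funext m; fin_cases m <;> rfl) (piPerc_mid_two_zero_le_blockAbar' p hv rfl _)
    · exact piPerc_grp_le _ _ _ 2 ![Sum.inr 2, Sum.inr 3] (by decide) (by decide)
        (by funext m; fin_cases m <;> rfl) (piPerc_end_zero_le_blockPE p rfl _ rfl)
  · have h3 := piPerc_inter_le_prod₃_of_witnessedι₀ p (C := clsSet (stepVec ι) w t t 2 0)
      (fun ω (hω : ω ∈ jointWitIotaII ι x (stepVec ι) v w t t) => hω.2.2.2.2.2)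
      (mk (l0Bw (stepVec ι) w t) (stepVec ι) v t x) (isFinitary_mk (isFinitary_l0Bw _ w t) _ v t x) grpιII₀
      grpιII₀_adm
      (fun ω hω hlat i K hK _ hL hI _ => by
        have hwe : w ≠ stepVec ι := (sideII_of_mem hω.1).2.1
        have hcl := notMem_of_subset hK ((mem_lineCls_two_iff (stepVec ι) w 0 ω).1 hω.2.1).2
        fin_cases i
        · exact mem_openConnGe_one_of_ne hL (Ne.symm hw0)
        · exact mem_openConnGe_two_of_notMem hL hwe hcl.2
        · exact mem_openConnGe_zero_of_mem hL
        · exact mem_openConnGe_zero_of_mem hL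
        · have hL' : K ∈ (openConn w t : Set (BondConfig (Site d))) := hL
          exact mem_openConnGe_zero_of_mem (SimpleGraph.Reachable.symm hL'))
      (mem_openConnEq_one_of_mem huv (Set.mem_singleton _)) (up₁ hvt)
    refine le_blocks_of_factors h3 ?_ ?_ ?_
    · exact piPerc_grp_le _ _ _ 0 ![Sum.inl (Sum.inl 0), Sum.inl (Sum.inl 1)] (by decide) (by decide)
        (by funext m; fin_cases m <;> rfl) (piPerc_iotaStart_two_base_ne_le_blockPiota p ι w _)
    · exact piPerc_grp_le _ _ _ 1 ![Sum.inl (Sum.inr 0), Sum.inr 0, Sum.inl (Sum.inl 4)] (by decide) (by decide)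
        (by funext m; fin_cases m <;> rfl) (piPerc_mid_two_zero_le_blockAbar' p hv rfl _)
    · exact piPerc_grp_le _ _ _ 2 ![Sum.inr 2, Sum.inr 3] (by decide) (by decide)
        (by funext m; fin_cases m <;> rfl) (piPerc_end_zero_le_blockPE p rfl _ rfl)

/-- **Class `(2,0)`, `u ≠ e_ι`**: both parts are live, bounded by the two summands of `P^{ι,2}(u,w)`.
[cite: FitznerVanDerHofstad2017, §6.1 proof of Lemma 5.3, Case a ≥ 2 with `u ≠ e_ι`, "Case a ≥ 2, b = 0"; (4.69); App. B rows b ≥ 2 of P^{ι,b} (arXiv:1506.07977v2 pp. 44, 59, 73)] -/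
theorem jointWitIota_cls_two_zero_of_ne {ι : Fin d × Bool} {u : Site d} (hu : u ≠ stepVec ι) (x v w z t : Site d) :
    ENNReal.ofReal (bondJ d p (v - u)) * piPerc d p 2 (jointWitIota ι x u v w z t ∩ clsSet u w t z 2 0) ≤
      ∑ κ : Fin d × Bool, (if v = u + stepVec κ then (1 : ℝ≥0∞) else 0) *
        (blockPiota (Letters.perc d p) ι 2 u w * blockAbar' (Letters.perc d p) κ 2 0 u w t z *
          blockPE (Letters.perc d p) 0 (t - x) (z - x)) := by
  classical
  refine ofReal_bondJ_mul_le_sum_ite p u v _ _ fun κ hv => ?_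
  by_cases hne : (jointWitIota ι x u v w z t ∩ clsSet u w t z 2 0).Nonempty
  swap
  · rw [Set.not_nonempty_iff_eq_empty.1 hne, measure_empty, mul_zero]; exact zero_le
  obtain ⟨ω₀, hω₀⟩ := hne
  obtain ⟨hs, huw, hzt⟩ := facts hω₀
  subst hzt
  have hvt : v ≠ t := fun h => hs.2.2.2.1 h.symm
  have huv : u ≠ v := (adj_of_eq_add_stepVec hv).ne
  refine mul_le_blocks_of_parts (piPerc_jointWitIota_inter_le_add p ι x u v w t t _) ?_ ?_
    (summands_le_blockPiota_two (Letters.perc d p) ι u w)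
  · -- part `I`
    rw [ofReal_mul_piPerc_eq_inter_of_preimage p hv
      ((measurableSet_jointWitIotaI ι x u v w t t).inter (measurableSet_clsSet u w t t 2 0))
      (eraseAt0_preimage_jointWitIotaI_inter_clsSet ι x u v w t t 2 0)]
    by_cases hw : w = stepVec ι
    · subst hw
      have h3 := piPerc_inter_le_prod₃_of_witnessedι₀ p (C := clsSet u (stepVec ι) t t 2 0)
        (fun ω (hω : ω ∈ jointWitIotaI ι x u v (stepVec ι) t t) => hω.2.2)
        (mk (l0Ie (stepVec ι) u t) u v t x) (isFinitary_mk (isFinitary_l0Ie _ u t) u v t x) grpιI₀ grpιI₀_adm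
        (fun ω hω hlat i K hK _ hL hI _ => by
          have hcl := notMem_of_subset hK ((mem_lineCls_two_iff u (stepVec ι) 0 ω).1 hω.2.1).2
          fin_cases i
          · exact mem_event_ge_three_zero_stepVec hlat hK hL (hI (by decide))
          · exact mem_openConnGe_zero_of_mem hL
          · exact mem_openConnGe_two_of_notMem hL (Ne.symm hu) hcl.2
          · have hL' : K ∈ (openConn (stepVec ι) t : Set (BondConfig (Site d))) := hL
            exact mem_openConnGe_zero_of_mem (SimpleGraph.Reachable.symm hL')
          · exact mem_openConnGe_two_of_notMem hL (Ne.symm hu) hcl.2)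
        (mem_openConnEq_one_of_mem huv (Set.mem_singleton _)) (up₁ hvt)
      refine le_blocks_of_factors h3 ?_ ?_ ?_
      · exact piPerc_grp_le _ _ _ 0 ![Sum.inl (Sum.inl 0), Sum.inl (Sum.inl 2), Sum.inl (Sum.inl 4)] (by decide)
          (by decide) (by funext m; fin_cases m <;> rfl) (piPerc_iotaStartI_two_ne_eq_le p ι hu _ rfl)
      · exact piPerc_grp_le _ _ _ 1 ![Sum.inl (Sum.inr 0), Sum.inr 0, Sum.inl (Sum.inl 3)] (by decide) (by decide)
          (by funext m; fin_cases m <;> rfl) (piPerc_mid_two_zero_le_blockAbar' p hv rfl _)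
      · exact piPerc_grp_le _ _ _ 2 ![Sum.inr 2, Sum.inr 3] (by decide) (by decide)
          (by funext m; fin_cases m <;> rfl) (piPerc_end_zero_le_blockPE p rfl _ rfl)
    · have h3 := piPerc_inter_le_prod₃_of_witnessedι₀ p (C := clsSet u w t t 2 0)
        (fun ω (hω : ω ∈ jointWitIotaI ι x u v w t t) => hω.2.2)
        (mk (l0Iw (stepVec ι) u w t) u v t x) (isFinitary_mk (isFinitary_l0Iw _ u w t) u v t x) grpιI₀ grpιI₀_adm
        (fun ω hω hlat i K hK _ hL hI _ => by
          have hcl := notMem_of_subset hK ((mem_lineCls_two_iff u w 0 ω).1 hω.2.1).2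
          fin_cases i
          · exact mem_event_ge_three_zero_stepVec hlat hK hL (hI (by decide))
          · have hL' : K ∈ (openConn (stepVec ι) w : Set (BondConfig (Site d))) := hL
            exact mem_openConnGe_one_of_ne (SimpleGraph.Reachable.symm hL') hw
          · have hL' : K ∈ (openConn w u : Set (BondConfig (Site d))) := hL
            exact mem_openConnGe_two_of_notMem (SimpleGraph.Reachable.symm hL') huw hcl.1
          · have hL' : K ∈ (openConn w t : Set (BondConfig (Site d))) := hL
            exact mem_openConnGe_zero_of_mem (SimpleGraph.Reachable.symm hL')
          · exact mem_openConnGe_one_of_ne hL (Ne.symm hu))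
        (mem_openConnEq_one_of_mem huv (Set.mem_singleton _)) (up₁ hvt)
      refine le_blocks_of_factors h3 ?_ ?_ ?_
      · exact piPerc_grp_le _ _ _ 0
          ![Sum.inl (Sum.inl 0), Sum.inl (Sum.inl 4), Sum.inl (Sum.inl 2), Sum.inl (Sum.inl 1)] (by decide)
          (by decide) (by funext m; fin_cases m <;> rfl) (piPerc_iotaStartI_two_ne_ne_le p ι hu hw _)
      · exact piPerc_grp_le _ _ _ 1 ![Sum.inl (Sum.inr 0), Sum.inr 0, Sum.inl (Sum.inl 3)] (by decide) (by decide)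
          (by funext m; fin_cases m <;> rfl) (piPerc_mid_two_zero_le_blockAbar' p hv rfl _)
      · exact piPerc_grp_le _ _ _ 2 ![Sum.inr 2, Sum.inr 3] (by decide) (by decide)
          (by funext m; fin_cases m <;> rfl) (piPerc_end_zero_le_blockPE p rfl _ rfl)
  · -- part `II`
    rw [ofReal_mul_piPerc_eq_inter_of_preimage p hv
      ((measurableSet_jointWitIotaII ι x u v w t t).inter (measurableSet_clsSet u w t t 2 0))
      (eraseAt0_preimage_jointWitIotaII_inter_clsSet ι x u v w t t 2 0)]
    by_cases hw0 : w = 0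
    · subst hw0
      have h3 := piPerc_inter_le_prod₃_of_witnessedι₀ p (C := clsSet u 0 t t 2 0)
        (fun ω (hω : ω ∈ jointWitIotaII ι x u v 0 t t) => hω.2.2.2.2.2)
        (mk (l0F0 (stepVec ι) u t) u v t x) (isFinitary_mk (isFinitary_l0F0 _ u t) u v t x) grpιII₀ grpιII₀_adm
        (fun ω hω hlat i K hK _ hL hI _ => by
          fin_cases i
          · exact mem_openConnGe_zero_of_mem hL
          · exact mem_event_ge_three_zero_stepVec hlat hK hL (hI (Finset.notMem_empty _))
          · exact mem_openConnGe_zero_of_mem hL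
          · exact mem_openConnGe_zero_of_mem hL
          · have hL' : K ∈ (openConn (0 : Site d) t : Set (BondConfig (Site d))) := hL
            exact mem_openConnGe_zero_of_mem (SimpleGraph.Reachable.symm hL'))
        (mem_openConnEq_one_of_mem huv (Set.mem_singleton _)) (up₁ hvt)
      refine le_blocks_of_factors h3 ?_ ?_ ?_
      · exact piPerc_grp_le _ _ _ 0 ![Sum.inl (Sum.inl 1), Sum.inl (Sum.inl 2), Sum.inl (Sum.inl 3)] (by decide)
          (by decide) (by funext m; fin_cases m <;> rfl) (piPerc_iotaStartII_two_far_zero_le p ι hu _ rfl)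
      · exact piPerc_grp_le _ _ _ 1 ![Sum.inl (Sum.inr 0), Sum.inr 0, Sum.inl (Sum.inl 4)] (by decide) (by decide)
          (by funext m; fin_cases m <;> rfl) (piPerc_mid_two_zero_le_blockAbar' p hv rfl _)
      · exact piPerc_grp_le _ _ _ 2 ![Sum.inr 2, Sum.inr 3] (by decide) (by decide)
          (by funext m; fin_cases m <;> rfl) (piPerc_end_zero_le_blockPE p rfl _ rfl)
    · have h3 := piPerc_inter_le_prod₃_of_witnessedι₀ p (C := clsSet u w t t 2 0)
        (fun ω (hω : ω ∈ jointWitIotaII ι x u v w t t) => hω.2.2.2.2.2)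
        (mk (l0Fw (stepVec ι) u w t) u v t x) (isFinitary_mk (isFinitary_l0Fw _ u w t) u v t x) grpιII₀ grpιII₀_adm
        (fun ω hω hlat i K hK _ hL hI _ => by
          have hwe : w ≠ stepVec ι := (sideII_of_mem hω.1).2.1
          fin_cases i
          · exact mem_openConnGe_one_of_ne hL (Ne.symm hw0)
          · exact mem_openConnGe_one_of_ne hL hwe
          · exact mem_openConnGe_zero_of_mem hL
          · exact mem_openConnGe_zero_of_mem hL
          · have hL' : K ∈ (openConn w t : Set (BondConfig (Site d))) := hL
            exact mem_openConnGe_zero_of_mem (SimpleGraph.Reachable.symm hL'))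
        (mem_openConnEq_one_of_mem huv (Set.mem_singleton _)) (up₁ hvt)
      refine le_blocks_of_factors h3 ?_ ?_ ?_
      · exact piPerc_grp_le _ _ _ 0
          ![Sum.inl (Sum.inl 0), Sum.inl (Sum.inl 1), Sum.inl (Sum.inl 2), Sum.inl (Sum.inl 3)] (by decide)
          (by decide) (by funext m; fin_cases m <;> rfl) (piPerc_iotaStartII_two_far_ne_le p ι hu w _ rfl)
      · exact piPerc_grp_le _ _ _ 1 ![Sum.inl (Sum.inr 0), Sum.inr 0, Sum.inl (Sum.inl 4)] (by decide) (by decide)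
          (by funext m; fin_cases m <;> rfl) (piPerc_mid_two_zero_le_blockAbar' p hv rfl _)
      · exact piPerc_grp_le _ _ _ 2 ![Sum.inr 2, Sum.inr 3] (by decide) (by decide)
          (by funext m; fin_cases m <;> rfl) (piPerc_end_zero_le_blockPE p rfl _ rfl)

/-- **[FvdH17] §6.1, Case `a = 2, b = 0` of (6.4) at `N = 1` for the `ι`-event.**
`J(v−u) ℙ_p^{⊗2}(jointWitIota ι x u v w z t ∩ class (2,0)) ≤ Σ_κ 𝟙{v = u+e_κ} P^{ι,2}(u,w) Ā'^{κ,2,0}(u,w,t,z) P^{E,0}(t−x,z−x)`.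
[cite: FitznerVanDerHofstad2017, §6.1 proof of Lemma 5.3, "Case a ≥ 2", "Case a ≥ 2, b = 0", right triangle b = 0 (arXiv:1506.07977v2 pp. 58–59)] -/
theorem jointWitIota_cls_two_zero (ι : Fin d × Bool) (x u v w z t : Site d) :
    ENNReal.ofReal (bondJ d p (v - u)) * piPerc d p 2 (jointWitIota ι x u v w z t ∩ clsSet u w t z 2 0) ≤
      ∑ κ : Fin d × Bool, (if v = u + stepVec κ then (1 : ℝ≥0∞) else 0) *
        (blockPiota (Letters.perc d p) ι 2 u w * blockAbar' (Letters.perc d p) κ 2 0 u w t z *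
          blockPE (Letters.perc d p) 0 (t - x) (z - x)) := by
  by_cases hu : u = stepVec ι
  exacts [jointWitIota_cls_two_zero_of_eq p hu x v w z t, jointWitIota_cls_two_zero_of_ne p hu x v w z t]

end

end Literature.Probability.FitznerVanDerHofstad2017
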